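import Mathlib

/-!
# The disjointness-injection lemma for down-sets (blind cell PercRepro2, p3 g22, 2026-08-28)

Every non-empty down-set `D` of the finite Boolean lattice of subsets of a finite set admits an
injection `φ : D → D` with `φ T` disjoint from `T` for every `T ∈ D`
(`exists_disjoint_injOn_of_downset`).  Proof by induction on the ground set: split `D` by a
point `x` into `D₀ = {T ∈ D : x ∉ T}` and `D₁′ = {T : T ∪ {x} ∈ D} ⊆ D₀`, take the injections
`φ₀`, `φ₁` of the two smaller down-sets (bijections, by finiteness), send `T ∪ {x}` to `φ₁ T`
and `T ∈ D₀` to `φ₀ T ∪ {x}` when `φ₀ T ∈ D₁′`, to `φ₀ T` otherwise.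

This is the combinatorial heart of `proofs/P3-CPNC.md` §19l: in a projection class of a
`G − d` block group the event «the A-side joins r and s» is a down-set of the cube of
(fixed blocks, moved super-components), and a pairing `(ω, T) ↦ (ω̄, φ T)` with `φ T ∩ T = ∅`
turns every `d`-avoiding `Y`-connection of `p, q` into a `W`-connection, which gives the sign
of the `D`-part of the single-`d` sum.  Own work, one seat.
-/

namespace Summit.Ventures.PercRepro2

namespace DownsetInjection

open Finset

variable {α : Type*} [DecidableEq α]

omit [DecidableEq α] in
/-- A non-empty down-set contains `∅`. -/
lemma empty_mem_of_downset {D : Finset (Finset α)} (hD : ∀ T ∈ D, ∀ T', T' ⊆ T → T' ∈ D)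
    (hne : D.Nonempty) : ∅ ∈ D := by
  obtain ⟨T, hT⟩ := hne
  exact hD T hT ∅ (Finset.empty_subset T)

/-- **The disjointness-injection lemma.** For every non-empty down-set `D` of subsets of `U`
there is `φ` mapping `D` into `D`, injective on `D`, with `φ T` disjoint from `T`. -/
theorem exists_disjoint_injOn_of_downset (U : Finset α) :
    ∀ D : Finset (Finset α), (∀ T ∈ D, T ⊆ U) → (∀ T ∈ D, ∀ T', T' ⊆ T → T' ∈ D) →
      D.Nonempty →
      ∃ φ : Finset α → Finset α, (∀ T ∈ D, φ T ∈ D ∧ Disjoint T (φ T)) ∧ Set.InjOn φ ↑D := by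
  induction U using Finset.induction_on with
  | empty =>
    intro D hU hD hne
    refine ⟨id, fun T hT => ⟨hT, ?_⟩, Set.injOn_id _⟩
    have : T = ∅ := Finset.subset_empty.1 (hU T hT)
    simp [this]
  | insert x U' hx ih =>
    intro D hU hD hne
    -- the two halves
    set D₀ : Finset (Finset α) := D.filter (fun T => x ∉ T) with hD₀def
    set D₁' : Finset (Finset α) := (D.filter (fun T => x ∈ T)).image (fun T => T.erase x)
      with hD₁def
    have hmemD₀ : ∀ {T}, T ∈ D₀ ↔ T ∈ D ∧ x ∉ T := by
      intro T; simp [hD₀def]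
    have hmemD₁ : ∀ {T'}, T' ∈ D₁' ↔ ∃ T ∈ D, x ∈ T ∧ T.erase x = T' := by
      intro T'
      simp only [hD₁def, Finset.mem_image, Finset.mem_filter]
      constructor
      · rintro ⟨T, ⟨hT, hxT⟩, h⟩; exact ⟨T, hT, hxT, h⟩
      · rintro ⟨T, hT, hxT, h⟩; exact ⟨T, ⟨hT, hxT⟩, h⟩
    have hD₀U : ∀ T ∈ D₀, T ⊆ U' := by
      intro T hT
      obtain ⟨hTD, hxT⟩ := hmemD₀.1 hT
      intro y hy
      have := hU T hTD hy
      rw [Finset.mem_insert] at this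
      rcases this with rfl | h
      · exact absurd hy hxT
      · exact h
    have hD₀down : ∀ T ∈ D₀, ∀ T', T' ⊆ T → T' ∈ D₀ := by
      intro T hT T' hT'
      obtain ⟨hTD, hxT⟩ := hmemD₀.1 hT
      exact hmemD₀.2 ⟨hD T hTD T' hT', fun h => hxT (hT' h)⟩
    have hD₀ne : D₀.Nonempty := ⟨∅, hmemD₀.2 ⟨empty_mem_of_downset hD hne, by simp⟩⟩
    have hD₁sub : D₁' ⊆ D₀ := by
      intro T' hT'
      obtain ⟨T, hTD, _, rfl⟩ := hmemD₁.1 hT'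
      exact hmemD₀.2 ⟨hD T hTD _ (Finset.erase_subset x T), Finset.notMem_erase x T⟩
    have hD₁U : ∀ T ∈ D₁', T ⊆ U' := fun T hT => hD₀U T (hD₁sub hT)
    have hD₁down : ∀ T ∈ D₁', ∀ T', T' ⊆ T → T' ∈ D₁' := by
      intro T' hT' T'' hT''
      obtain ⟨T, hTD, hxT, rfl⟩ := hmemD₁.1 hT'
      have hxT'' : x ∉ T'' := fun h => Finset.notMem_erase x T (hT'' h)
      have hins : insert x T'' ∈ D := by
        refine hD T hTD _ ?_
        intro y hy
        rw [Finset.mem_insert] at hy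
        rcases hy with rfl | hy
        · exact hxT
        · exact Finset.mem_of_mem_erase (hT'' hy)
      exact hmemD₁.2 ⟨insert x T'', hins, Finset.mem_insert_self x T'',
        Finset.erase_insert hxT''⟩
    -- the injection on `D₀`
    obtain ⟨φ₀, hφ₀, hφ₀inj⟩ := ih D₀ hD₀U hD₀down hD₀ne
    by_cases hD₁ne : D₁'.Nonempty
    · obtain ⟨φ₁, hφ₁, hφ₁inj⟩ := ih D₁' hD₁U hD₁down hD₁ne
      -- `φ₁` is onto `D₁'`
      have hφ₁surj : ∀ T' ∈ D₁', ∃ T ∈ D₁', φ₁ T = T' := by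
        intro T' hT'
        obtain ⟨T, hT, hTT'⟩ := Finset.surj_on_of_inj_on_of_card_le (s := D₁') (t := D₁')
          (fun T _ => φ₁ T) (fun T hT => (hφ₁ T hT).1)
          (fun T₁ T₂ h₁ h₂ h => hφ₁inj h₁ h₂ h) le_rfl T' hT'
        exact ⟨T, hT, hTT'.symm⟩
      -- the combined map
      let φ : Finset α → Finset α := fun T =>
        if x ∈ T then φ₁ (T.erase x) else if φ₀ T ∈ D₁' then insert x (φ₀ T) else φ₀ T
      refine ⟨φ, ?_, ?_⟩
      · intro T hT
        by_cases hxT : x ∈ T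
        · have hTe : T.erase x ∈ D₁' := hmemD₁.2 ⟨T, hT, hxT, rfl⟩
          obtain ⟨hmem, hdisj⟩ := hφ₁ _ hTe
          have hmem₀ := hD₁sub hmem
          obtain ⟨hmemD, hxφ⟩ := hmemD₀.1 hmem₀
          have hφT : φ T = φ₁ (T.erase x) := by simp [φ, hxT]
          rw [hφT]
          refine ⟨hmemD, ?_⟩
          rw [Finset.disjoint_left]
          intro y hyT hyφ
          by_cases hyx : y = x
          · exact hxφ (hyx ▸ hyφ)
          · exact Finset.disjoint_left.1 hdisj (Finset.mem_erase.2 ⟨hyx, hyT⟩) hyφ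
        · have hT₀ : T ∈ D₀ := hmemD₀.2 ⟨hT, hxT⟩
          obtain ⟨hmem, hdisj⟩ := hφ₀ T hT₀
          by_cases hφ₀T : φ₀ T ∈ D₁'
          · have hφT : φ T = insert x (φ₀ T) := by simp [φ, hxT, hφ₀T]
            rw [hφT]
            obtain ⟨T₁, hT₁, hxT₁, hT₁e⟩ := hmemD₁.1 hφ₀T
            have : insert x (φ₀ T) = T₁ := by rw [← hT₁e, Finset.insert_erase hxT₁]
            refine ⟨this ▸ hT₁, ?_⟩
            rw [Finset.disjoint_insert_right]
            exact ⟨hxT, hdisj⟩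
          · have hφT : φ T = φ₀ T := by simp [φ, hxT, hφ₀T]
            rw [hφT]
            exact ⟨(hmemD₀.1 hmem).1, hdisj⟩
      · intro T hT T' hT' hTT'
        simp only [Finset.mem_coe] at hT hT'
        have hx₁ : ∀ {S}, S ∈ D₁' → x ∉ S := fun hS => (hmemD₀.1 (hD₁sub hS)).2
        by_cases hxT : x ∈ T <;> by_cases hxT' : x ∈ T'
        · -- both contain `x`
          have h1 : φ T = φ₁ (T.erase x) := by simp [φ, hxT]
          have h2 : φ T' = φ₁ (T'.erase x) := by simp [φ, hxT']
          rw [h1, h2] at hTT'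
          have hTe : T.erase x ∈ D₁' := hmemD₁.2 ⟨T, hT, hxT, rfl⟩
          have hTe' : T'.erase x ∈ D₁' := hmemD₁.2 ⟨T', hT', hxT', rfl⟩
          have := hφ₁inj (Finset.mem_coe.2 hTe) (Finset.mem_coe.2 hTe') hTT'
          rw [← Finset.insert_erase hxT, ← Finset.insert_erase hxT', this]
        · -- `x ∈ T`, `x ∉ T'`
          exfalso
          have h1 : φ T = φ₁ (T.erase x) := by simp [φ, hxT]
          have hTe : T.erase x ∈ D₁' := hmemD₁.2 ⟨T, hT, hxT, rfl⟩
          have hin : φ T ∈ D₁' := h1 ▸ (hφ₁ _ hTe).1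
          by_cases hφ₀T' : φ₀ T' ∈ D₁'
          · have h2 : φ T' = insert x (φ₀ T') := by simp [φ, hxT', hφ₀T']
            have : x ∈ φ T := by rw [hTT', h2]; exact Finset.mem_insert_self x _
            exact hx₁ hin this
          · have h2 : φ T' = φ₀ T' := by simp [φ, hxT', hφ₀T']
            rw [hTT', h2] at hin
            exact hφ₀T' hin
        · -- `x ∉ T`, `x ∈ T'`
          exfalso
          have h2 : φ T' = φ₁ (T'.erase x) := by simp [φ, hxT']
          have hTe' : T'.erase x ∈ D₁' := hmemD₁.2 ⟨T', hT', hxT', rfl⟩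
          have hin : φ T' ∈ D₁' := h2 ▸ (hφ₁ _ hTe').1
          by_cases hφ₀T : φ₀ T ∈ D₁'
          · have h1 : φ T = insert x (φ₀ T) := by simp [φ, hxT, hφ₀T]
            have : x ∈ φ T' := by rw [← hTT', h1]; exact Finset.mem_insert_self x _
            exact hx₁ hin this
          · have h1 : φ T = φ₀ T := by simp [φ, hxT, hφ₀T]
            rw [← hTT', h1] at hin
            exact hφ₀T hin
        · -- neither contains `x`
          have hT₀ : T ∈ D₀ := hmemD₀.2 ⟨hT, hxT⟩
          have hT₀' : T' ∈ D₀ := hmemD₀.2 ⟨hT', hxT'⟩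
          have hxφ₀ : x ∉ φ₀ T := (hmemD₀.1 (hφ₀ T hT₀).1).2
          have hxφ₀' : x ∉ φ₀ T' := (hmemD₀.1 (hφ₀ T' hT₀').1).2
          by_cases hφ₀T : φ₀ T ∈ D₁' <;> by_cases hφ₀T' : φ₀ T' ∈ D₁'
          · have h1 : φ T = insert x (φ₀ T) := by simp [φ, hxT, hφ₀T]
            have h2 : φ T' = insert x (φ₀ T') := by simp [φ, hxT', hφ₀T']
            rw [h1, h2] at hTT'
            have : φ₀ T = φ₀ T' := by
              have := congrArg (fun S => S.erase x) hTT'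
              simpa [Finset.erase_insert hxφ₀, Finset.erase_insert hxφ₀'] using this
            exact hφ₀inj (Finset.mem_coe.2 hT₀) (Finset.mem_coe.2 hT₀') this
          · exfalso
            have h1 : φ T = insert x (φ₀ T) := by simp [φ, hxT, hφ₀T]
            have h2 : φ T' = φ₀ T' := by simp [φ, hxT', hφ₀T']
            have : x ∈ φ₀ T' := by rw [← h2, ← hTT', h1]; exact Finset.mem_insert_self x _
            exact hxφ₀' this
          · exfalso
            have h1 : φ T = φ₀ T := by simp [φ, hxT, hφ₀T]
            have h2 : φ T' = insert x (φ₀ T') := by simp [φ, hxT', hφ₀T']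
            have : x ∈ φ₀ T := by rw [← h1, hTT', h2]; exact Finset.mem_insert_self x _
            exact hxφ₀ this
          · have h1 : φ T = φ₀ T := by simp [φ, hxT, hφ₀T]
            have h2 : φ T' = φ₀ T' := by simp [φ, hxT', hφ₀T']
            rw [h1, h2] at hTT'
            exact hφ₀inj (Finset.mem_coe.2 hT₀) (Finset.mem_coe.2 hT₀') hTT'
    · -- `D₁'` empty: every member of `D` avoids `x`, so `D = D₀`
      have hD₁empty : D₁' = ∅ := Finset.not_nonempty_iff_eq_empty.1 hD₁ne
      have hDeq : D = D₀ := by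
        ext T
        rw [hmemD₀]
        constructor
        · intro hT
          refine ⟨hT, fun hxT => ?_⟩
          have : T.erase x ∈ D₁' := hmemD₁.2 ⟨T, hT, hxT, rfl⟩
          rw [hD₁empty] at this
          exact Finset.notMem_empty _ this
        · exact fun h => h.1
      refine ⟨φ₀, fun T hT => ?_, ?_⟩
      · have hT₀ : T ∈ D₀ := hDeq ▸ hT
        exact ⟨(hmemD₀.1 (hφ₀ T hT₀).1).1, (hφ₀ T hT₀).2⟩
      · rw [hDeq]; exact hφ₀inj

end DownsetInjection

end Summit.Ventures.PercRepro2
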